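import Literature.NumberTheory.Automorphic.UnboundedDenominatorsProofs
import Literature.NumberTheory.Automorphic.UnboundedDenominatorsIharaEnhancedProofs

/-!
# The unbounded denominators theorem (Calegari–Dimitrov–Tang) — Theorem 4.3.1 in the printed form `f(pτ)`

Ninth sibling of `Literature/NumberTheory/Automorphic/UnboundedDenominators.lean`; joins
`UnboundedDenominatorsProofs.lean` (§4.3 ¶1: `f(pτ)` is a modular form on `A⁻¹ G A ∩ SL₂(ℤ)`,
`exists_modularForm_conjGL_apply_diag_smul`, `slash_diag_apply`) with
`UnboundedDenominatorsIharaEnhancedProofs.lean` (Theorem 4.3.1 ⟸ {amalgam + CSP sentence,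
Corollary 4.5.3}, stated with `f ∣ₖ A = p^{k-1} f(pτ)`). Sorry-free theorems only; NO definition,
NO named fact (D-0026). Source: F. Calegari, V. Dimitrov, Y. Tang, *The unbounded denominators
conjecture*, J. Amer. Math. Soc. **38** (2025), 627–702 = arXiv:2109.09040v4, §4.3 Theorem 4.3.1.

* (private) `slash_diag_eq_smul_of_apply_eq` — `f ∣ₖ A = p^{k-1} · F` when `F(τ) = f(pτ)`.
* `exists_congruence_modularForm_of_apply_diag_smul_invariant` — **Theorem 4.3.1 as printed** (in
  hypothesis form for its two §4 inputs): `G ≤ SL(2, ℤ)` normal of finite index with all conjugates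
  of `Tᴺ`, `p ∤ N` prime, `A = diag(p, 1)`; if the modular form `F(τ) = f(pτ)` on `A⁻¹ G A ∩ SL₂(ℤ)`
  is invariant under `G ∩ Γ(N p)` (as it is when `f(pτ)` lies in the `M_{Np}`-algebra generated by
  `R_N`), then `f` is congruence-modular;
  `exists_mem_inf_slash_ne_of_not_congruence` — contrapositive: for noncongruence `f`, `f(pτ)` is
  NOT invariant under `G ∩ Γ(N p)`.
-/

noncomputable section

namespace Literature.NumberTheory.Automorphic

open scoped MatrixGroups ModularForm
open CongruenceSubgroup Matrix.SpecialLinearGroup ModularGroup UpperHalfPlane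

variable {G : Subgroup SL(2, ℤ)} {N p : ℕ} {A : GL (Fin 2) ℝ} {k : ℤ}

/-- `f ∣ₖ A = p^{k-1} · F` as functions on `ℍ`, when `F(τ) = f(A • τ) = f(pτ)` pointwise
(`A = diag(p, 1)`; `slash_diag_apply`). [folklore] -/
private lemma slash_diag_eq_smul_of_apply_eq (hA : (A : Matrix (Fin 2) (Fin 2) ℝ) = !![(p : ℝ), 0; 0, 1])
    (f F : ℍ → ℂ) (hF : ∀ τ, F τ = f (A • τ)) :
    f ∣[k] A = ((p : ℂ) ^ (k - 1)) • F := by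
  funext τ
  rw [slash_diag_apply hA f k τ, Pi.smul_apply, smul_eq_mul, hF]

/-- **CDT Theorem 4.3.1 in the printed form** [cite: CalegariDimitrovTang2025, Theorem 4.3.1]
(hypothesis form for the two §4 inputs: the amalgam + congruence-subgroup-property sentence `hker₂`
and Corollary 4.5.3 `hcor`, see `UnboundedDenominatorsIharaEnhancedProofs.lean`). Let
`G ≤ SL(2, ℤ)` be normal of finite index containing every conjugate of `Tᴺ` (CDT's `G_N`), `p` a
prime not dividing `N ≠ 0`, `A = diag(p, 1)`, `f` a weight-`k` modular form on `G` and `F` the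
modular form `τ ↦ f(pτ)` on `A⁻¹ G A ∩ SL₂(ℤ)` (`exists_modularForm_conjGL_apply_diag_smul`). If `F`
is invariant under `G ∩ Γ(N p)` — which is the case as soon as `f(pτ)` lies in the `M_{Np}`-algebra
generated by `R_N`, all of whose elements are invariant under `G ∩ ⟨E, Γ(N p)⟩` — then `f` is a
modular form on a congruence subgroup. -/
theorem exists_congruence_modularForm_of_apply_diag_smul_invariant [G.Normal] [G.FiniteIndex]
    (hT : ∀ g : SL(2, ℤ), g * T ^ N * g⁻¹ ∈ G) (hN : N ≠ 0) (hp : p.Prime) (hNp : N.Coprime p)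
    (hA : (A : Matrix (Fin 2) (Fin 2) ℝ) = !![(p : ℝ), 0; 0, 1])
    (hker₂ : ∀ (Δ : Type) [Group Δ] [Finite Δ] (g₁ g₂ : Gamma N →* Δ),
      (∀ (x : SL(2, ℤ)) (hx : x ∈ Gamma N), x ∈ Gamma0 p → ∀ (y : SL(2, ℤ)) (hy : y ∈ Gamma N),
        A * mapGL ℝ x = mapGL ℝ y * A → g₁ ⟨x, hx⟩ = g₂ ⟨y, hy⟩) →
      (∃ M : ℕ, M ≠ 0 ∧ ∀ (x : SL(2, ℤ)) (hx : x ∈ Gamma N), x ∈ Gamma M → g₁ ⟨x, hx⟩ = 1) ∧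
      (∃ M : ℕ, M ≠ 0 ∧ ∀ (x : SL(2, ℤ)) (hx : x ∈ Gamma N), x ∈ Gamma M → g₂ ⟨x, hx⟩ = 1))
    (hcor : ∀ (Q : Type) [CommGroup Q] [Finite Q] (θ : Gamma N →* Q),
      (∀ g : SL(2, ℤ), ∃ M : ℕ, M ≠ 0 ∧ ∀ (x : SL(2, ℤ)) (hx : x ∈ Gamma N)
        (hgx : g * x * g⁻¹ ∈ Gamma N), x ∈ Gamma M → θ ⟨g * x * g⁻¹, hgx⟩ = θ ⟨x, hx⟩) →
      ∃ M : ℕ, M ≠ 0 ∧ ∀ (x : SL(2, ℤ)) (hx : x ∈ Gamma N), x ∈ Gamma M → θ ⟨x, hx⟩ = 1)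
    (f : ModularForm (G : Subgroup (GL (Fin 2) ℝ)) k)
    (F : ModularForm ((conjGL G A : Subgroup SL(2, ℤ)) : Subgroup (GL (Fin 2) ℝ)) k)
    (hF : ∀ τ, F τ = f (A • τ))
    (hinv : ∀ γ ∈ G ⊓ Gamma (N * p), (⇑F : ℍ → ℂ) ∣[k] (mapGL ℝ γ) = ⇑F) :
    ∃ (Γ' : Subgroup SL(2, ℤ)) (g : ModularForm (Γ' : Subgroup (GL (Fin 2) ℝ)) k),
      IsCongruenceSubgroup Γ' ∧ (g : ℍ → ℂ) = f := by
  refine exists_congruence_modularForm_of_slash_diag_invariant_of_ker_congruence₂_of_cor453 hT hN hp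
    hNp hA hker₂ hcor f fun γ hγ ↦ ?_
  have h1 : (((p : ℂ) ^ (k - 1)) • (⇑F : ℍ → ℂ)) ∣[k] (mapGL ℝ γ) =
      ((p : ℂ) ^ (k - 1)) • ((⇑F : ℍ → ℂ) ∣[k] (mapGL ℝ γ)) :=
    ModularForm.SL_smul_slash k γ (⇑F) ((p : ℂ) ^ (k - 1))
  rw [slash_diag_eq_smul_of_apply_eq hA (⇑f) (⇑F) hF, h1, hinv γ hγ]

/-- **CDT Theorem 4.3.1, contrapositive (as printed)** [cite: CalegariDimitrovTang2025,
Theorem 4.3.1]: under the same hypotheses, if `f` is not modular for any congruence subgroup, then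
the form `F(τ) = f(pτ)` on `A⁻¹ G A ∩ SL₂(ℤ)` is not invariant under `G ∩ Γ(N p)`; in particular
`f(pτ)` does not lie in the `M_{Np}`-algebra generated by `R_N`. -/
theorem exists_mem_inf_slash_ne_of_not_congruence [G.Normal] [G.FiniteIndex]
    (hT : ∀ g : SL(2, ℤ), g * T ^ N * g⁻¹ ∈ G) (hN : N ≠ 0) (hp : p.Prime) (hNp : N.Coprime p)
    (hA : (A : Matrix (Fin 2) (Fin 2) ℝ) = !![(p : ℝ), 0; 0, 1])
    (hker₂ : ∀ (Δ : Type) [Group Δ] [Finite Δ] (g₁ g₂ : Gamma N →* Δ),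
      (∀ (x : SL(2, ℤ)) (hx : x ∈ Gamma N), x ∈ Gamma0 p → ∀ (y : SL(2, ℤ)) (hy : y ∈ Gamma N),
        A * mapGL ℝ x = mapGL ℝ y * A → g₁ ⟨x, hx⟩ = g₂ ⟨y, hy⟩) →
      (∃ M : ℕ, M ≠ 0 ∧ ∀ (x : SL(2, ℤ)) (hx : x ∈ Gamma N), x ∈ Gamma M → g₁ ⟨x, hx⟩ = 1) ∧
      (∃ M : ℕ, M ≠ 0 ∧ ∀ (x : SL(2, ℤ)) (hx : x ∈ Gamma N), x ∈ Gamma M → g₂ ⟨x, hx⟩ = 1))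
    (hcor : ∀ (Q : Type) [CommGroup Q] [Finite Q] (θ : Gamma N →* Q),
      (∀ g : SL(2, ℤ), ∃ M : ℕ, M ≠ 0 ∧ ∀ (x : SL(2, ℤ)) (hx : x ∈ Gamma N)
        (hgx : g * x * g⁻¹ ∈ Gamma N), x ∈ Gamma M → θ ⟨g * x * g⁻¹, hgx⟩ = θ ⟨x, hx⟩) →
      ∃ M : ℕ, M ≠ 0 ∧ ∀ (x : SL(2, ℤ)) (hx : x ∈ Gamma N), x ∈ Gamma M → θ ⟨x, hx⟩ = 1)
    (f : ModularForm (G : Subgroup (GL (Fin 2) ℝ)) k)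
    (hf : ¬ ∃ (Γ' : Subgroup SL(2, ℤ)) (g : ModularForm (Γ' : Subgroup (GL (Fin 2) ℝ)) k),
      IsCongruenceSubgroup Γ' ∧ (g : ℍ → ℂ) = f)
    (F : ModularForm ((conjGL G A : Subgroup SL(2, ℤ)) : Subgroup (GL (Fin 2) ℝ)) k)
    (hF : ∀ τ, F τ = f (A • τ)) :
    ∃ γ ∈ G ⊓ Gamma (N * p), (⇑F : ℍ → ℂ) ∣[k] (mapGL ℝ γ) ≠ ⇑F := by
  by_contra h
  push Not at h
  exact hf (exists_congruence_modularForm_of_apply_diag_smul_invariant hT hN hp hNp hA hker₂ hcor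
    f F hF h)

end Literature.NumberTheory.Automorphic

end
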